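import Mathlib
import HarnessLib
import Summits.KontsevichZagierPeriods.KontsevichZagierPeriods.Theses.FurushoPentagon
import Summits.KontsevichZagierPeriods.KontsevichZagierPeriods.Theorems.FurushoPentagonKernelModuloPeriodConjectureLeafLowWeight
import Summits.KontsevichZagierPeriods.KontsevichZagierPeriods.Theorems.FurushoPentagonKernelModuloPeriodConjectureLeafWeightFive
import Summits.KontsevichZagierPeriods.KontsevichZagierPeriods.Theorems.FurushoPentagonKernelModuloPeriodConjectureLeafWeightSix
import Summits.KontsevichZagierPeriods.KontsevichZagierPeriods.Theorems.FurushoPentagonKernelModuloPeriodConjectureLeafWeightSeven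
import Summits.KontsevichZagierPeriods.KontsevichZagierPeriods.Theorems.FurushoPentagonKernelModuloPeriodConjectureLeafWeightEight
import Summits.KontsevichZagierPeriods.KontsevichZagierPeriods.Theorems.FurushoPentagonKernelModuloPeriodConjectureMzvSectorLeafOn

/-!
# `KernelModuloPeriodConjecture`, line `Sketch`: the crux on the multiple-zeta sector through weight 8

Crux `FurushoPentagon.KernelModuloPeriodConjecture` (stmt-KontsevichZagierPeriods-15058,
`MzvPeriodConjecture → PentagonInKZ → ReducedPeriodRing → SectorToKernel`), line `Sketch`.
Assembling the landed per-weight slices of the algebraic leaf `AssociatorHoffmanSpanning`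
(weight `≤ 4`: `associatorHoffmanSpanning_of_weight_le_four`; weights 5–8:
`stub_leafWeightFive/Six/Seven/Eight`, generated exact-`ℚ` certificates from Furusho's double
shuffle for pentagon solutions) with the localisation of the sector transfer
(`mzvSectorKernel_of_leafOn`) gives the crux ON THE SPAN OF THE SIMPLEX REPRESENTATIONS OF WEIGHT
`≤ 8`, with no open leaf left:

  `MzvPeriodConjecture → PentagonInKZ → ReducedPeriodRing →`
  `∀ c ∈ ⟨[mzvRep s] : s admissible, |s| ≤ 8⟩_ℤ, KZ.eval c = 0 → c ∈ KZ.relations`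

(`kernelModuloPeriodConjecture_weight_le_eight`). What remains of the crux is the leaf in weights
`≥ 9` (`GRT₁ ≅ U^{dR}_{MT(ℤ)}` in coordinates) on the sector, and Conjecture 1 off the sector.

References: F. Brown, Ann. of Math. 175 (2012), Thm 1.1 [Brown2012]; H. Furusho, Ann. of Math. 174
(2011), Thm 1.2 [Furusho2011]; K. Ihara, M. Kaneko, D. Zagier, Compos. Math. 142 (2006), §2
[IharaKanekoZagier2006]; M. Kontsevich, D. Zagier, *Periods* (2001), §1.2 [KontsevichZagier2001].
-/

noncomputable section

namespace Summit.KontsevichZagierPeriods.FurushoPentagon.KernelModuloPeriodConjecture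

open Literature.NumberTheory.Transcendental
open Literature.NumberTheory.Transcendental.KZ
open Summit.KontsevichZagierPeriods.KontsevichZagierPeriods.Theses.FurushoPentagon

/-- **The algebraic leaf `AssociatorHoffmanSpanning` through weight 8**: for every admissible index
of weight `≤ 8` one rational Hoffman certificate valid at every group-like pentagon solution over
every (reduced) commutative `ℚ`-algebra (weight `≤ 4`: tree; weights 5–8: the landed slices).
[cite: IharaKanekoZagier2006, §2] -/
theorem associatorHoffmanSpanning_of_weight_le_eight {s : List ℕ} (hs : MZV.IsAdmissible s)
    (hw : MZV.weight s ≤ 8) :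
    ∃ b : List ℕ →₀ ℚ, (∀ t ∈ b.support, MZV.IsHoffman t ∧ MZV.weight t = MZV.weight s) ∧ ∀ (R : Type) [CommRing R] [Algebra ℚ R] [IsReduced R] (φ : NCSeries Bool R), NCSeries.IsGroupLike φ → NCSeries.DrinfeldPentagon φ → φ (MZV.binaryWord s) = b.sum (fun t q => q • φ (MZV.binaryWord t)) := by
  by_cases h4 : MZV.weight s ≤ 4
  · exact associatorHoffmanSpanning_of_weight_le_four hs h4
  by_cases h5 : MZV.weight s = 5
  · exact stub_leafWeightFive s hs h5
  by_cases h6 : MZV.weight s = 6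
  · exact stub_leafWeightSix s hs h6
  by_cases h7 : MZV.weight s = 7
  · exact stub_leafWeightSeven s hs h7
  exact stub_leafWeightEight s hs (by omega)

/-- **The MZV-sector kernel through weight 8.** Under `PentagonInKZ`, `ReducedPeriodRing` and
`MzvPeriodConjecture`, every `ℤ`-combination of simplex representations `[mzvRep s]` of weights
`≤ 8` with value `0` lies in `KZ.relations`. [cite: KontsevichZagier2001, §1.2] -/
theorem mzvSectorKernel_of_weight_le_eight (hP : PentagonInKZ) (hR : ReducedPeriodRing)
    (hZ : MzvPeriodConjecture) :
    ∀ c ∈ AddSubgroup.closure (Set.range (fun s : {s : List ℕ // MZV.IsAdmissible s ∧ MZV.weight s ≤ 8} =>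
      KZ.of (KZ.mzvRep s.1 s.2.1 (KZ.mzvIntegrand_isSemialgebraicFunOn_holds s.1)
        (KZ.mzvIntegrand_integrableOn_holds s.1 s.2.1)))), KZ.eval c = 0 → c ∈ KZ.relations :=
  mzvSectorKernel_of_leafOn (fun s => MZV.weight s ≤ 8)
    (fun _ hs hw => associatorHoffmanSpanning_of_weight_le_eight hs hw) hP hR hZ

/-- **Registered sub-goal `stub_kernelModuloPeriodConjectureWeightLeEight`** (crux
stmt-KontsevichZagierPeriods-15058, line `Sketch`): THE CRUX ON THE MULTIPLE-ZETA SECTOR THROUGH WEIGHT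
8, in the crux's own shape — `MzvPeriodConjecture → PentagonInKZ → ReducedPeriodRing →` Conjecture 1 in
kernel form on the subgroup of `KZ.FormalRep` generated by the simplex representations of admissible
indices of weight `≤ 8`. [cite: KontsevichZagier2001, §1.2] -/
theorem stub_kernelModuloPeriodConjectureWeightLeEight : MzvPeriodConjecture → PentagonInKZ → ReducedPeriodRing → ∀ c ∈ AddSubgroup.closure (Set.range (fun s : {s : List ℕ // MZV.IsAdmissible s ∧ MZV.weight s ≤ 8} => KZ.of (KZ.mzvRep s.1 s.2.1 (KZ.mzvIntegrand_isSemialgebraicFunOn_holds s.1) (KZ.mzvIntegrand_integrableOn_holds s.1 s.2.1)))), KZ.eval c = 0 → c ∈ KZ.relations :=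
  fun hZ hP hR => mzvSectorKernel_of_weight_le_eight hP hR hZ

end Summit.KontsevichZagierPeriods.FurushoPentagon.KernelModuloPeriodConjecture

end
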